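import Literature.NumberTheory.Transcendental.SemialgebraicRiemannSum
import Literature.NumberTheory.Transcendental.SemialgebraicTraceElementary
import Literature.NumberTheory.Transcendental.PeriodConjecture
import Literature.Computability.Complexity.ElementaryRealProofs
import Mathlib.MeasureTheory.Measure.Lebesgue.EqHaar
import Mathlib.Analysis.Normed.Group.Bounded
import HarnessLib

/-!
# Volumes of bounded `ℚ`-semialgebraic sets are elementary real numbers

**Theorem** (`IsSemialgebraic.isElementaryReal_volume`; Tent–Ziegler, Münster J. Math. 3 (2010),
Cor. 6.3 "The volumes of bounded semialgebraic sets are lower elementary"; Yoshinaga,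
arXiv:0805.0349 (2008), Lemmas 26 and 29, the two halves of the proof of his Thm. 18 once the period
has been reduced to volumes of bounded sets).  For every bounded `ℚ`-semialgebraic `D ⊆ ℝ^m` the
Lebesgue volume `vol(D)` is an elementary real number in the sense of
`Literature.Computability.Complexity.IsElementaryReal` (Kalmár-elementary `1/(n+1)`-approximations;
we prove "elementary", which is what Yoshinaga states, not Tent–Ziegler's sharper "lower
elementary").

Proof: translate `D` by an integer vector into a box `[0, R)^m` (volume and `ℚ`-semialgebraicity are
preserved); there `|vol(D) - (R/n)^m · #{k : (R kᵢ/n)ᵢ ∈ D}| ≤ c/n`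
(`exists_abs_volume_sub_riemannSum_le`, the grid lemma) and the count is an elementary function of
`n` (`IsSemialgebraic.elementaryRec_card_gridPoints`), so `vol(D)` is elementary by
`IsElementaryReal.of_nat_approx`.

**Reduction of Yoshinaga's main theorem** (`isElementaryReal_of_isRealPeriod_of_volume_reduction`):
the named fact `isElementaryReal_of_isRealPeriod` (Yoshinaga 2008, Thm. 18: real periods are
elementary) follows from the above and the one remaining deep input, taken here as an explicit
hypothesis and *not* asserted: every real period is a difference of volumes of two bounded
`ℚ`-semialgebraic sets (Yoshinaga 2008, Lemma 24; Viu-Sos, arXiv:1509.01097 = Int. J. Number Theory 17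
(2021), Cor. 2.3; Belkale–Brosnan 2003 — all via Hironaka's resolution of singularities).

## References

* K. Tent, M. Ziegler, *Computable functions of reals*, Münster J. Math. 3 (2010), 43–66, Cor. 6.3,
  Cor. 6.4.
* M. Yoshinaga, *Periods and elementary real numbers*, arXiv:0805.0349 (2008), Thm. 18, Lemma 24,
  Lemma 26, Lemma 29.
* J. Viu-Sos, *A semi-canonical reduction for periods of Kontsevich–Zagier*, Int. J. Number Theory
  17 (2021), arXiv:1509.01097, Thm. 1.1, Cor. 2.3.
-/

noncomputable section

open MeasureTheory Finset Literature.Computability.Complexity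

namespace Literature.NumberTheory.Transcendental

/-! ### Sets in a box -/

/-- **Volumes of `ℚ`-semialgebraic subsets of a box are elementary** (Tent–Ziegler 2010, Cor. 6.3;
Yoshinaga 2008, Lemmas 26 + 29): for `D ⊆ [0, R)^{m+1}` `ℚ`-semialgebraic, `vol(D)` is an
elementary real, by the effective Riemann sums `|vol(D) - (R/n)^{m+1} #_n| ≤ c / n` with elementary
counts `#_n`. [cite: TentZiegler2010, Corollary 6.3] -/
theorem _root_.Literature.ModelTheory.ExponentialFields.IsSemialgebraic.isElementaryReal_volume_of_subset_box
    {m : ℕ} {D : Set (Fin (m + 1) → ℝ)}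
    (hD : Literature.ModelTheory.ExponentialFields.IsSemialgebraic ℚ D) {R : ℕ} (hR : 0 < R)
    (hDR : ∀ x ∈ D, ∀ i, 0 ≤ x i ∧ x i < R) : IsElementaryReal (volume.real D) := by
  classical
  obtain ⟨c, hc⟩ := exists_abs_volume_sub_riemannSum_le hD hR hDR
  refine IsElementaryReal.of_nat_approx
    (fun n => R ^ (m + 1) * (Finset.univ.filter fun k : Fin (m + 1) → Fin n =>
      (fun i => ((R : ℝ) / n) * ((k i : ℕ) : ℝ)) ∈ D).card)
    (fun n => n ^ (m + 1)) c ?_ ?_ (fun N hN => Nat.one_le_pow _ _ hN) (fun N hN => ?_)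
  · exact (ElementaryRec.const _).mul' (hD.elementaryRec_card_gridPoints R)
  · exact ElementaryRec.id'.pow' (ElementaryRec.const _)
  · have hN0 : (N : ℝ) ≠ 0 := by exact_mod_cast (Nat.one_le_iff_ne_zero.1 hN)
    convert hc N hN using 3
    push_cast
    rw [div_pow]
    field_simp

/-! ### Bounded sets: translation into a box -/

/-- Translating by a constant rational vector preserves `ℚ`-semialgebraicity. [folklore] -/
theorem _root_.Literature.ModelTheory.ExponentialFields.IsSemialgebraic.preimage_sub_const {M : ℕ}
    {D : Set (Fin M → ℝ)} (hD : Literature.ModelTheory.ExponentialFields.IsSemialgebraic ℚ D) (s : ℚ) :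
    Literature.ModelTheory.ExponentialFields.IsSemialgebraic ℚ
      ((fun y : Fin M → ℝ => fun i => y i - (s : ℝ)) ⁻¹' D) := by
  convert hD.preimage_aeval (fun j : Fin M => (MvPolynomial.X j - MvPolynomial.C s :
    MvPolynomial (Fin M) ℚ)) using 3 with y
  ext j
  simp

/-- In dimension `0` every subset of `ℝ^0` has volume `0` or `1`. [folklore] -/
theorem volume_real_fin_zero (D : Set (Fin 0 → ℝ)) : volume.real D = 0 ∨ volume.real D = 1 := by
  rcases Set.eq_empty_or_nonempty D with rfl | ⟨x, hx⟩
  · left; simp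
  · right
    have hD : D = Set.univ := Set.eq_univ_of_forall fun y => by rwa [Subsingleton.elim y x]
    rw [hD, measureReal_def, volume_pi, Measure.pi_univ]
    simp

/-- **Volumes of bounded `ℚ`-semialgebraic sets are elementary reals** (Tent–Ziegler 2010,
Cor. 6.3 — there "lower elementary"; Yoshinaga 2008, Lemmas 26 and 29 for bounded basic open sets).
[cite: TentZiegler2010, Corollary 6.3] -/
theorem _root_.Literature.ModelTheory.ExponentialFields.IsSemialgebraic.isElementaryReal_volume
    {m : ℕ} {D : Set (Fin m → ℝ)} (hD : Literature.ModelTheory.ExponentialFields.IsSemialgebraic ℚ D)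
    (hb : Bornology.IsBounded D) : IsElementaryReal (volume.real D) := by
  cases m with
  | zero =>
    rcases volume_real_fin_zero D with h | h <;> rw [h]
    · exact IsElementaryReal.zero
    · simpa using IsElementaryReal.natCast 1
  | succ m =>
    obtain ⟨r, hr⟩ := isBounded_iff_forall_norm_le.1 hb
    -- integer shift `s ≥ r` and box size `R = 2 s + 1`
    set s : ℕ := ⌈r⌉₊ with hs
    have hsr : r ≤ s := Nat.le_ceil r
    set D' : Set (Fin (m + 1) → ℝ) := (fun y : Fin (m + 1) → ℝ => fun i => y i - ((s : ℚ) : ℝ)) ⁻¹' D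
      with hD'
    have hD's : Literature.ModelTheory.ExponentialFields.IsSemialgebraic ℚ D' := hD.preimage_sub_const s
    -- the translate lies in the box `[0, 2 s + 1)^{m+1}`
    have hbox : ∀ y ∈ D', ∀ i, 0 ≤ y i ∧ y i < ((2 * s + 1 : ℕ) : ℝ) := by
      intro y hy i
      have hyD : (fun i => y i - ((s : ℚ) : ℝ)) ∈ D := hy
      have h1 : |y i - s| ≤ r := by
        have := (norm_le_pi_norm (fun i => y i - ((s : ℚ) : ℝ)) i).trans (hr _ hyD)
        simpa [Real.norm_eq_abs] using this
      rw [abs_le] at h1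
      push_cast
      constructor <;> linarith
    -- same volume
    have hvol : volume.real D' = volume.real D := by
      have : D' = (fun y : Fin (m + 1) → ℝ => (-fun _ => ((s : ℚ) : ℝ)) + y) ⁻¹' D := by
        ext y
        simp only [hD', Set.mem_preimage]
        congr! 1
        funext i
        simp [neg_add_eq_sub]
      rw [measureReal_def, measureReal_def, this, measure_preimage_add]
    rw [← hvol]
    exact hD's.isElementaryReal_volume_of_subset_box (by positivity) hbox

/-! ### Reduction of Yoshinaga's main theorem to the bounded-volume reduction -/

/-- **Yoshinaga's theorem from the reduction to bounded volumes.**  If every real period is a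
difference of volumes of two bounded `ℚ`-semialgebraic sets (Yoshinaga 2008, Lemma 24; Viu-Sos 2021,
Cor. 2.3; via resolution of singularities — taken here as a hypothesis, not asserted), then every
real period is an elementary real number (the named fact `isElementaryReal_of_isRealPeriod`,
Yoshinaga 2008, Thm. 18), by `IsSemialgebraic.isElementaryReal_volume` and closure of the elementary
reals under subtraction. [cite: Yoshinaga2008, Theorem 18 and Lemma 24] -/
theorem isElementaryReal_of_isRealPeriod_of_volume_reduction
    (hred : ∀ x : ℝ, IsRealPeriod x →
      ∃ (m : ℕ) (K₁ K₂ : Set (Fin m → ℝ)),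
        Literature.ModelTheory.ExponentialFields.IsSemialgebraic ℚ K₁ ∧
        Literature.ModelTheory.ExponentialFields.IsSemialgebraic ℚ K₂ ∧
        Bornology.IsBounded K₁ ∧ Bornology.IsBounded K₂ ∧
        x = volume.real K₁ - volume.real K₂) :
    isElementaryReal_of_isRealPeriod := by
  intro x hx
  obtain ⟨m, K₁, K₂, h₁, h₂, b₁, b₂, rfl⟩ := hred x hx
  exact (h₁.isElementaryReal_volume b₁).sub (h₂.isElementaryReal_volume b₂)

/-- **Yoshinaga's theorem from his Lemma 24 as printed** ("`P` is generated by the volumes of bounded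
basic open semi-algebraic sets", additive form): if every real period lies in the additive subgroup
of `ℝ` generated by the volumes of bounded `ℚ`-semialgebraic sets (hypothesis, not asserted: its
printed proof uses Belkale–Brosnan's description of periods and Hironaka's rectilinearization), then
every real period is an elementary real (`isElementaryReal_of_isRealPeriod`, Yoshinaga 2008,
Thm. 18), by `IsSemialgebraic.isElementaryReal_volume` and
`IsElementaryReal.of_mem_addSubgroupClosure` (Prop. 10). [cite: Yoshinaga2008, Theorem 18 and Lemma 24] -/
theorem isElementaryReal_of_isRealPeriod_of_mem_closure_volumes
    (hred : ∀ x : ℝ, IsRealPeriod x →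
      x ∈ AddSubgroup.closure {v : ℝ | ∃ (m : ℕ) (D : Set (Fin m → ℝ)),
        Literature.ModelTheory.ExponentialFields.IsSemialgebraic ℚ D ∧ Bornology.IsBounded D ∧
        v = volume.real D}) :
    isElementaryReal_of_isRealPeriod := by
  intro x hx
  refine IsElementaryReal.of_mem_addSubgroupClosure (fun v hv => ?_) (hred x hx)
  obtain ⟨m, D, hD, hb, rfl⟩ := hv
  exact hD.isElementaryReal_volume hb

end Literature.NumberTheory.Transcendental
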